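import Mathlib
import HarnessLib

/-!
# Kill test `SurfaceTermination` (stmt-ResolutionOfSingularities-16488), toric slice — TORIC CORE of THEOREM 11
# (KERNEL-g20): the «cone minimum» lemma behind invertibility of full sheaves, and the «discrete convexity ⇒
# interval» lemma behind the vanishing `H¹(X̃, ℳ_t⁻¹) = 0` for Wunram's special full sheaves (LEMMA V)

Route `ResolutionOfSingularities/HomologicalConductor`, chain W4.4, lead res-L0-w44-lead-1 gen 20, KERNEL-g20 §2.1 / §2.4.
`[OURS]` — AI-formalised, weaker than expert review; NOT a statement of any manuscript under review (Hironaka 2017).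
SUPPORT-level, counted 0, def-free and fact-free.

THEOREM 11 of KERNEL-g20 (hand proof): for every cyclic quotient surface germ `1/d(1,q)` the cohomology-annihilator tower of
the route terminates along every valuation after at most `r(d,q)` singular stages (HJ-substring dynamics).  Two elementary
combinatorial statements carry the toric part of the proof; they are recorded here in checked form.

* `coneMin_mem`, `coneMin_mem_left`, `coneMin_mem_right` (KERNEL-g20 2.1 (E2)): in the chart basis dual to two consecutive
  rays `P_s, P_{s+1}` of the minimal resolution, the real quadrant becomes a homogeneous cone `{m₁ α ≤ β ≤ m₂ α}` (`0 ≤ m₁`),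
  resp. `{0 ≤ α, m₁ α ≤ β}` / `{0 ≤ β, m₁ β ≤ α}` at the two ends; if `(α₀, β₁)` and `(α₂, β₀)` lie in the cone with
  `α₀ ≤ α₂`, `β₀ ≤ β₁`, then so does the componentwise minimum `(α₀, β₀)`.  Consequence: the exponents of the class-`χ`
  monomials in a chart have a UNIQUE componentwise minimum, i.e. the full sheaf `S_χ·𝒪_X̃` is invertible on the minimal
  resolution (every characteristic).
* `nonpos_of_discreteConvex`, `posSet_ordConnected` (KERNEL-g20 2.4 (iii)): an integer sequence `φ` on `0..r+1` with
  `φ(ρ−1) + φ(ρ+1) = a_ρ φ(ρ) + ε_ρ` (`1 ≤ ρ ≤ r`), `a_ρ ≥ 2`, `ε` vanishing off one index `t` and `ε_t ≤ 1`, has its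
  positivity set `{ρ | 0 < φ ρ}` an interval.  In LEMMA V, `φ(ρ) = ord_{E_ρ}(n) − h_t(ρ)` for a lattice point `n` of the
  special class `i_t`, `a_ρ = −E_ρ²`, `ε_ρ = deg_{E_ρ} ℳ_t = δ_{ρt}`; by the Demazure–CLS formula `H¹(X̃, ℳ_t⁻¹)` is the
  sum over `n` of `H̃⁰` of the positivity set, which vanishes because an interval of the chain is connected.
-/

-- single-problem summit: the doubled namespace component is forced
set_option linter.dupNamespace false

namespace Summit.ResolutionOfSingularities.ResolutionOfSingularities.Theorems.SurfaceTermination.ToricCore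

/-! ## 1. The cone-minimum lemma (invertibility of rank-one full sheaves on the minimal resolution) -/

/-- **Cone minimum, interior chart.** In the cone `{(α, β) | m₁ α ≤ β ∧ β ≤ m₂ α}` with `0 ≤ m₁`: if `(α₀, β₁)` satisfies
the upper constraint, `(α₂, β₀)` the lower one, and `α₀ ≤ α₂`, `β₀ ≤ β₁`, then `(α₀, β₀)` lies in the cone. [KERNEL-g20 2.1] -/
theorem coneMin_mem {m₁ m₂ α₀ α₂ β₀ β₁ : ℚ} (hm₁ : 0 ≤ m₁) (hα : α₀ ≤ α₂) (hβ : β₀ ≤ β₁)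
    (h₁ : β₁ ≤ m₂ * α₀) (h₂ : m₁ * α₂ ≤ β₀) :
    m₁ * α₀ ≤ β₀ ∧ β₀ ≤ m₂ * α₀ :=
  ⟨(mul_le_mul_of_nonneg_left hα hm₁).trans h₂, hβ.trans h₁⟩

/-- **Cone minimum, first chart** (`s = 0`): the cone `{(α, β) | 0 ≤ α ∧ m₁ α ≤ β}`, `0 ≤ m₁`. [KERNEL-g20 2.1] -/
theorem coneMin_mem_left {m₁ α₀ α₂ β₀ : ℚ} (hm₁ : 0 ≤ m₁) (hα : α₀ ≤ α₂)
    (h₁ : 0 ≤ α₀) (h₂ : m₁ * α₂ ≤ β₀) :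
    0 ≤ α₀ ∧ m₁ * α₀ ≤ β₀ :=
  ⟨h₁, (mul_le_mul_of_nonneg_left hα hm₁).trans h₂⟩

/-- **Cone minimum, last chart** (`s = r`): the cone `{(α, β) | 0 ≤ β ∧ m₁ β ≤ α}`, `0 ≤ m₁`. [KERNEL-g20 2.1] -/
theorem coneMin_mem_right {m₁ α₀ β₀ β₁ : ℚ} (hm₁ : 0 ≤ m₁) (hβ : β₀ ≤ β₁)
    (h₁ : m₁ * β₁ ≤ α₀) (h₂ : 0 ≤ β₀) :
    0 ≤ β₀ ∧ m₁ * β₀ ≤ α₀ :=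
  ⟨h₂, (mul_le_mul_of_nonneg_left hβ hm₁).trans h₁⟩

/-- **Unique minimum of a cone subset.** If `S ⊆ {m₁ α ≤ β ≤ m₂ α}` (`0 ≤ m₁`) contains a point with least first
coordinate and a point with least second coordinate, then the componentwise minimum lies in the cone and is below
every point of `S` — the shape in which 2.1 is used (`S` = chart exponents of the class-`χ` monomials). [KERNEL-g20 2.1] -/
theorem coneMin_isLeast {m₁ m₂ : ℚ} (hm₁ : 0 ≤ m₁) {S : Set (ℚ × ℚ)}
    (hS : ∀ p ∈ S, m₁ * p.1 ≤ p.2 ∧ p.2 ≤ m₂ * p.1)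
    {p₁ p₂ : ℚ × ℚ} (hp₁ : p₁ ∈ S) (hp₂ : p₂ ∈ S)
    (hmin₁ : ∀ p ∈ S, p₁.1 ≤ p.1) (hmin₂ : ∀ p ∈ S, p₂.2 ≤ p.2) :
    (m₁ * p₁.1 ≤ p₂.2 ∧ p₂.2 ≤ m₂ * p₁.1) ∧ ∀ p ∈ S, p₁.1 ≤ p.1 ∧ p₂.2 ≤ p.2 := by
  refine ⟨?_, fun p hp => ⟨hmin₁ p hp, hmin₂ p hp⟩⟩
  exact coneMin_mem hm₁ (hmin₁ p₂ hp₂) (hmin₂ p₁ hp₁) (hS p₁ hp₁).2 (hS p₂ hp₂).1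

/-! ## 2. Discrete convexity along an HJ chain ⇒ the positivity set is an interval -/

/-- **Propagation.** Let `φ, a, ε : ℕ → ℤ` satisfy `φ ρ + φ (ρ+2) = a (ρ+1) * φ (ρ+1) + ε (ρ+1)` whenever `ρ + 1 ≤ r`,
with `a σ ≥ 2` for `1 ≤ σ ≤ r`, `ε σ = 0` for `σ ≠ t` and `ε t ≤ 1`.  If `φ k > 0` and `φ (k+1) ≤ 0`, then `φ ≤ 0` at
every later index up to `r + 1`, and the forward differences from `k` on are `≤ 0` (and `≤ −1` before the index `t`).
[KERNEL-g20 2.4 (iii)] -/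
theorem nonpos_of_discreteConvex (r t : ℕ) (φ a ε : ℕ → ℤ)
    (ha : ∀ σ, 1 ≤ σ → σ ≤ r → 2 ≤ a σ)
    (hε : ∀ σ, σ ≠ t → ε σ = 0) (hεt : ε t ≤ 1)
    (hrec : ∀ ρ, ρ + 1 ≤ r → φ ρ + φ (ρ + 2) = a (ρ + 1) * φ (ρ + 1) + ε (ρ + 1))
    (k : ℕ) (hk : 0 < φ k) (hk1 : φ (k + 1) ≤ 0) :
    ∀ n, k + 1 + n ≤ r + 1 →
      φ (k + 1 + n) ≤ 0 ∧ φ (k + 1 + n) - φ (k + n) ≤ 0 ∧ (k + n < t → φ (k + 1 + n) - φ (k + n) ≤ -1) := by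
  intro n
  induction n with
  | zero =>
    intro _
    refine ⟨by simpa using hk1, ?_, fun _ => ?_⟩
    · simp only [Nat.add_zero]; omega
    · simp only [Nat.add_zero]; omega
  | succ n ih =>
    intro hle
    have hle' : k + 1 + n ≤ r + 1 := by omega
    obtain ⟨hφ, hδ, hδt⟩ := ih hle'
    -- the recursion at ρ + 1 = k + n + 1 (so ρ = k + n), available since k + n + 1 ≤ r
    have hr : k + n + 1 ≤ r := by omega
    have hrec' := hrec (k + n) hr
    have ha' : 2 ≤ a (k + n + 1) := ha (k + n + 1) (by omega) hr
    -- rewrite indices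
    have e1 : k + 1 + n = k + n + 1 := by omega
    have e2 : k + 1 + (n + 1) = k + n + 2 := by omega
    have e3 : k + (n + 1) = k + n + 1 := by omega
    rw [e1] at hφ hδ hδt
    rw [e2, e3]
    -- (a - 2) * φ(ρ+1) ≤ 0 since a ≥ 2 and φ(ρ+1) ≤ 0
    have hprod : (a (k + n + 1) - 2) * φ (k + n + 1) ≤ 0 :=
      mul_nonpos_of_nonneg_of_nonpos (by linarith) hφ
    -- forward difference δ_{ρ+1} = (a-2) φ(ρ+1) + δ_ρ + ε(ρ+1)
    have hdiff : φ (k + n + 2) - φ (k + n + 1)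
        = (a (k + n + 1) - 2) * φ (k + n + 1) + (φ (k + n + 1) - φ (k + n)) + ε (k + n + 1) := by
      linear_combination hrec'
    by_cases hkt : k + n + 1 = t
    · -- the kink index: ε ≤ 1 and the previous difference is ≤ -1 (since k + n < t)
      have hprev : φ (k + n + 1) - φ (k + n) ≤ -1 := hδt (by omega)
      have hεle : ε (k + n + 1) ≤ 1 := by rw [hkt]; exact hεt
      refine ⟨?_, ?_, fun h => ?_⟩
      · nlinarith [hdiff, hprod, hprev, hεle, hφ]
      · nlinarith [hdiff, hprod, hprev, hεle]
      · exfalso; omega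
    · have hε0 : ε (k + n + 1) = 0 := hε _ hkt
      refine ⟨?_, ?_, fun h => ?_⟩
      · nlinarith [hdiff, hprod, hδ, hε0, hφ]
      · nlinarith [hdiff, hprod, hδ, hε0]
      · have hprev : φ (k + n + 1) - φ (k + n) ≤ -1 := hδt (by omega)
        nlinarith [hdiff, hprod, hprev, hε0]

/-- **Discrete convexity ⇒ interval.** Under the hypotheses of `nonpos_of_discreteConvex`, if `φ α > 0` and
`φ β ≤ 0` for some `α < β`, then `φ γ ≤ 0` for every `γ` with `β ≤ γ ≤ r + 1`: the positivity set
`{ρ ≤ r+1 | 0 < φ ρ}` is an interval.  This is the combinatorial content of `H¹(X̃, ℳ_t⁻¹) = 0` for the special full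
sheaves of a cyclic quotient surface germ (KERNEL-g20 LEMMA V). [KERNEL-g20 2.4 (iii)] -/
theorem nonpos_after_of_discreteConvex (r t : ℕ) (φ a ε : ℕ → ℤ)
    (ha : ∀ σ, 1 ≤ σ → σ ≤ r → 2 ≤ a σ)
    (hε : ∀ σ, σ ≠ t → ε σ = 0) (hεt : ε t ≤ 1)
    (hrec : ∀ ρ, ρ + 1 ≤ r → φ ρ + φ (ρ + 2) = a (ρ + 1) * φ (ρ + 1) + ε (ρ + 1))
    {α β γ : ℕ} (hαβ : α < β) (hβγ : β ≤ γ) (hγ : γ ≤ r + 1) (hα : 0 < φ α) (hβ : φ β ≤ 0) :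
    φ γ ≤ 0 := by
  classical
  -- the first index after α where φ is nonpositive
  have hex : ∃ m, α < m ∧ φ m ≤ 0 := ⟨β, hαβ, hβ⟩
  set β' := Nat.find hex with hβ'def
  have hβ'spec : α < β' ∧ φ β' ≤ 0 := Nat.find_spec hex
  have hβ'le : β' ≤ β := Nat.find_min' hex ⟨hαβ, hβ⟩
  -- write β' = k + 1 with φ k > 0
  obtain ⟨k, hk⟩ : ∃ k, β' = k + 1 := ⟨β' - 1, by omega⟩
  have hφk : 0 < φ k := by
    by_cases hkα : k = α
    · rw [hkα]; exact hα
    · have hlt : α < k := by omega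
      have hkmin : ¬ (α < k ∧ φ k ≤ 0) := Nat.find_min hex (show k < β' by omega)
      by_contra hle
      exact hkmin ⟨hlt, not_lt.mp hle⟩
  have hk1 : φ (k + 1) ≤ 0 := by rw [← hk]; exact hβ'spec.2
  obtain ⟨n, hn⟩ : ∃ n, γ = k + 1 + n := ⟨γ - (k + 1), by omega⟩
  have := nonpos_of_discreteConvex r t φ a ε ha hε hεt hrec k hφk hk1 n (by omega)
  rw [hn]; exact this.1

/-- **The positivity set is order-connected** (set-theoretic packaging of the previous theorem). [KERNEL-g20 2.4 (iii)] -/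
theorem posSet_ordConnected (r t : ℕ) (φ a ε : ℕ → ℤ)
    (ha : ∀ σ, 1 ≤ σ → σ ≤ r → 2 ≤ a σ)
    (hε : ∀ σ, σ ≠ t → ε σ = 0) (hεt : ε t ≤ 1)
    (hrec : ∀ ρ, ρ + 1 ≤ r → φ ρ + φ (ρ + 2) = a (ρ + 1) * φ (ρ + 1) + ε (ρ + 1)) :
    Set.OrdConnected {ρ : ℕ | ρ ≤ r + 1 ∧ 0 < φ ρ} := by
  refine ⟨fun α hαS γ hγS β hβ => ?_⟩
  obtain ⟨hαβ, hβγ⟩ := hβ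
  refine ⟨hβγ.trans hγS.1, ?_⟩
  by_contra hnot
  have hβ0 : φ β ≤ 0 := not_lt.mp hnot
  rcases hαβ.lt_or_eq with hlt | heq
  · have := nonpos_after_of_discreteConvex r t φ a ε ha hε hεt hrec hlt hβγ hγS.1 hαS.2 hβ0
    exact absurd hγS.2 (not_lt.mpr this)
  · exact hnot (heq ▸ hαS.2)

/-! ## 3. Total index of the cells (KERNEL-g20 PROPOSITION 4.5): telescoping from three-term convexity -/

/-- **Total index ≤ d, combinatorial core** (KERNEL-g20 PROP 4.5). For the rays `P₀, P_{s₁}, …, P_{s_k}, P_{r+1}` of the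
normal fan of the cohomology-annihilator ideal of `1/d(1,q)` put `D j l := d² · |det(P_{s_j}, P_{s_l})|`; the cell between
consecutive survivors has index `D j (j+1) / d`, and convexity of the ray chain towards the origin gives the three-term inequality
`D 0 k + D k l ≤ D 0 l` (`0 < k < l`).  Then the indices telescope: `∑_{j<m} D j (j+1) ≤ D 0 m` (`= d²·|det(P₀,P_{r+1})| = d²`),
i.e. the cell indices sum to at most `d`.  Stated for any function `D` into an ordered additive commutative monoid. [KERNEL-g20 4.5] -/
theorem sum_consecutive_le_of_threeTerm {α : Type*} [AddCommMonoid α] [PartialOrder α] [IsOrderedAddMonoid α]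
    (D : ℕ → ℕ → α) (m : ℕ) (hm : 1 ≤ m)
    (h : ∀ k l, 0 < k → k < l → l ≤ m → D 0 k + D k l ≤ D 0 l) :
    ∑ j ∈ Finset.range m, D j (j + 1) ≤ D 0 m := by
  induction m, hm using Nat.le_induction with
  | base => simp
  | succ n hn ih =>
    have ih' : ∑ j ∈ Finset.range n, D j (j + 1) ≤ D 0 n :=
      ih (fun k l hk hkl hl => h k l hk hkl (hl.trans (Nat.le_succ n)))
    rw [Finset.sum_range_succ]
    calc ∑ j ∈ Finset.range n, D j (j + 1) + D n (n + 1)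
        ≤ D 0 n + D n (n + 1) := by gcongr
      _ ≤ D 0 (n + 1) := h n (n + 1) hn (Nat.lt_succ_self n) le_rfl

end Summit.ResolutionOfSingularities.ResolutionOfSingularities.Theorems.SurfaceTermination.ToricCore
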